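import Summits.HubbardSuperconductivity.HubbardSuperconductivity.Theorems.AnisotropyChordStiffnessDoobTeleportFamilies
import Summits.HubbardSuperconductivity.HubbardSuperconductivity.Theorems.AnisotropyChordStiffnessOperatorLink

/-!
# Route `AnisotropyChord` / H0 rotor rung: DEFECT DECONFINEMENT IN PLACE OF THE STIFFNESS HYPOTHESIS — the converse
# rung N⁻ (`…StiffnessDoobTeleportFamilies`, theory seat `hubbard-h0-rotor-theory-1`, cycle 10) plugged into the
# tree's H0 chains

N⁻ (`variationalTwistStiffness(N)_of_goodTeleportFamilies(N)`) discharges hypothesis (S_tw) of H0 from the typed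
defect-deconfinement hypothesis `GoodTeleportFamilies(N) Δ M κ C`.  Composing with the tree's end-to-end theorems gives:
* **`eventualCondensate_of_goodTeleportFamilies`** (two-sector chain, `…StiffnessVariationalResponse`):
  `GoodTeleportFamilies ∧ VariationalDensityResponse ∧ GaussianInsertionComparison ⇒ EventualCondensate`;
* **`eventualCondensate_of_goodTeleportFamiliesN`** (one-state chain): `GoodTeleportFamiliesN ∧ VariationalDensityResponseN
  ∧ TeleGaussianComparison ⇒ EventualCondensate`;
* **`eventual_lambda_ge_of_goodTeleportFamiliesN`** — the same in the ROUTE'S order-parameter currency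
  (`…StiffnessOperatorLink`): `∃ c > 0, ∀ᶠ L`, every normalised sector-`M_L` ground state `ψ` of `H(Δ)` has
  `c·L⁴ ≤ Re⟨ψ, S⁺_tot S⁻_tot ψ⟩`.
So in the H0 programme «(S)+(K)+(H1′) ⇒ BEC» the stiffness input (S) may be replaced by «one-particle defects are
deconfined along winding cycles of cheap sites» (memo ROTOR-THEORY-10 §141).  Nothing here claims any of the hypotheses.
-/

set_option linter.dupNamespace false

noncomputable section

open Matrix Complex Finset Filter Topology
open Literature.MathematicalPhysics.QuantumLattice hiding torusPhase torusNorm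
open Literature.Probability.LatticeModels
open Summit.HubbardSuperconductivity.HubbardSuperconductivity.Theorems.AnisotropyChord.InsertionEntropy
  (IsPerronSectorGroundAmplitude TeleGaussianComparison GaussianInsertionComparison EventualCondensate)

namespace Summit.HubbardSuperconductivity.HubbardSuperconductivity.Theorems.AnisotropyChord.Stiffness.Doob

/-- **Two-sector H0 chain with (S) replaced by defect deconfinement:** along `ρ_L → ρ ∈ (0,1)` (adjacent sectors
non-empty), `GoodTeleportFamilies Δ M κ C` + variational bounded density response (K) + infrared Gaussianity (H1′)
⇒ `EventualCondensate Δ M`. [folklore] -/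
theorem eventualCondensate_of_goodTeleportFamilies (Δ : ℝ) (M : ℕ → ℝ) {κ C : ℝ} (hκ : 0 < κ) (hC : 0 < C)
    (ρ : ℝ) (hρ : ρ ∈ Set.Ioo (0 : ℝ) 1)
    (hlim : Tendsto (fun L : ℕ => 1 / 2 + M L / (L : ℝ) ^ 2) atTop (nhds ρ))
    (hsect : ∀ᶠ L : ℕ in atTop, ∀ [NeZero L], spinZSector (Λ := TorusSite 2 L) 1 (M L - 1) ≠ ⊥)
    (hG : GoodTeleportFamilies Δ M κ C) (hK : VariationalDensityResponse Δ M)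
    (hH : GaussianInsertionComparison Δ M) : EventualCondensate Δ M :=
  eventualCondensate_of_variational_hypotheses Δ M ρ hρ hlim hsect
    (variationalTwistStiffness_of_goodTeleportFamilies Δ M hκ hC hG) hK hH

/-- **One-state H0 chain with (S) replaced by defect deconfinement:** along `ρ_L → ρ ∈ (0,1)`,
`GoodTeleportFamiliesN Δ M κ C` + (K) in φ-form on the sector sequence + the one-state Gaussian comparison (H1⁗)
⇒ `EventualCondensate Δ M`. [folklore] -/
theorem eventualCondensate_of_goodTeleportFamiliesN (Δ : ℝ) (M : ℕ → ℝ) {κ C : ℝ} (hκ : 0 < κ) (hC : 0 < C)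
    (ρ : ℝ) (hρ : ρ ∈ Set.Ioo (0 : ℝ) 1)
    (hlim : Tendsto (fun L : ℕ => 1 / 2 + M L / (L : ℝ) ^ 2) atTop (nhds ρ))
    (hG : GoodTeleportFamiliesN Δ M κ C) (hK : VariationalDensityResponseN Δ M)
    (hT : TeleGaussianComparison Δ M) : EventualCondensate Δ M :=
  eventualCondensate_of_oneState_variational_hypotheses Δ M ρ hρ hlim
    (variationalTwistStiffnessN_of_goodTeleportFamiliesN Δ M hκ hC hG) hK hT

/-- **The same in the ROUTE'S CURRENCY:** `GoodTeleportFamiliesN ∧ VariationalDensityResponseN ∧ TeleGaussianComparison`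
along `ρ_L → ρ ∈ (0,1)` give `∃ c₀ > 0, ∀ᶠ L`, every normalised sector-`M_L` ground state `ψ` of `H(Δ)` has
`c₀·L⁴ ≤ Re⟨ψ, (Σ_x S⁺_x)(Σ_y S⁻_y) ψ⟩` (tree `Stiffness.eventual_lambda_ge_of_variational_hypotheses`). [folklore] -/
theorem eventual_lambda_ge_of_goodTeleportFamiliesN (Δ : ℝ) (M : ℕ → ℝ) {κ C : ℝ} (hκ : 0 < κ) (hC : 0 < C)
    (ρ : ℝ) (hρ : ρ ∈ Set.Ioo (0 : ℝ) 1)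
    (hlim : Tendsto (fun L : ℕ => 1 / 2 + M L / (L : ℝ) ^ 2) atTop (nhds ρ))
    (hG : GoodTeleportFamiliesN Δ M κ C) (hK : VariationalDensityResponseN Δ M)
    (hT : TeleGaussianComparison Δ M) :
    ∃ c₀ > (0 : ℝ), ∀ᶠ L : ℕ in atTop, ∀ [NeZero L], ∀ ψ : TensorIndex (TorusSite 2 L) 2 → ℂ,
      ψ ∈ spinZSector (Λ := TorusSite 2 L) 1 (M L) → star ψ ⬝ᵥ ψ = 1 →
        hcbHamiltonian L Δ *ᵥ ψ = ((lowestEnergyInSector 1 (hcbHamiltonian L Δ) (M L) : ℝ) : ℂ) • ψ →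
          c₀ * (L : ℝ) ^ 4 ≤ (star ψ ⬝ᵥ (((∑ x : TorusSite 2 L, onSite x (spinRaise 1))
              * (∑ y : TorusSite 2 L, onSite y (spinLower 1)) : Op (TorusSite 2 L) 2) *ᵥ ψ)).re :=
  eventual_lambda_ge_of_variational_hypotheses Δ M ρ hρ hlim
    (variationalTwistStiffnessN_of_goodTeleportFamiliesN Δ M hκ hC hG) hK hT

end Summit.HubbardSuperconductivity.HubbardSuperconductivity.Theorems.AnisotropyChord.Stiffness.Doob
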